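import Literature.AnabelianGeometry.AbsoluteAnabelian.AbsTopIII.CyclotomeSynchronizationSchemata
import Literature.AnabelianGeometry.AbsoluteAnabelian.AbsTopIII.CcnTransgression
import HarnessLib

/-!
# [AbsTopIII] Thm. 1.9 (b) / Cor. 1.10 (ii)(c) relative to a `CurveModel`: the Prop. 1.4 named facts
# do NOT imply them over the interface (joint-closure refutations for F-0346 / F-0348)

S. Mochizuki, *Topics in Absolute Anabelian Geometry III*, §1 (kurims manuscript, lit key
`paper:url-5493eb38cbb7`): Prop. 1.4 (i)/(ii) p. 31, Thm. 1.9 (b) p. 37, Cor. 1.10 (ii)(c) p. 42.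
Cell abc-iut, block F, seat abc-iut-f-079 (tranche 79), sequel of
`CyclotomeSynchronizationSchemata.lean` (p429113: the plain universal closures of F-0346
`CurveModel.Thm_1_9_b` and F-0348 `CurveModel.Cor_1_10_ii_c` are refuted).  PROOF-ONLY (no `def`, no
instance, no named fact; witnesses built inside the theorem terms).

The conditional lane discharges Thm. 1.9 (b) at every law-abiding model MODULO the four named facts
`Prop_1_4_i` (F-0339), `Prop_1_4_i'` (F-0340), `Prop_1_4_ii` (F-0341), `Prop_1_4_ii_transgression`
(F-0338) (`CoherentKummerModel.thm_1_9_b`, `Thm19bPresentationsProofs.lean`).  This file records WHICH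
of these carry content over the bare interface:

* `CurveModel.not_forall_thm_1_9_b_of_prop_1_4` — the JOINT closure
  `∀ M, Prop_1_4_i M → Prop_1_4_i' M → Prop_1_4_ii M → Thm_1_9_b M` is FALSE: the two-point witness of
  the sibling file (`Π_U = Ẑ × G_ℚ ↠ G_ℚ`, one rational cusp, `I_z = Δ_U ≅ Ẑ`; `Π_Z = G_ℚ`) satisfies
  (i), (i′), (ii) — kernel `Δ_U` closed, normal, commutative (`mul_comm_of_dense_zpowers`), so the
  cuspidally central extension is exact as typed — while `M_Z` is trivial.  So, over the interface, the
  content of (b) sits in the Leray-differential fact F-0338 and in the model laws (neither is examined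
  here; note that the TARGET `H²(Δ_Z, Ẑ)` of the transgression vanishes at this witness);
* `CurveModel.not_forall_cor_1_10_ii_c_of_prop_1_4` — the joint closure of Cor. 1.10 (ii)(c) under ALL
  FOUR Prop. 1.4 facts AND Thm. 1.9 (b) is FALSE: at the one-point witness over `ℚ_2` (no cusps,
  `res = 𝟙`) every cusp-indexed fact holds vacuously and (i′) genuinely, `M_X` is trivial, and
  `μ_Ẑ(G_{ℚ_2}) ≠ 1` (PROVED local class field theory, `exists_muZhat_mulEquiv_cyclotome_units_of_isMLF`).

HONEST FRAMING: statements about OUR typed interface (R5: these rows are consumable only at a named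
model), not about print's Thm. 1.9 / Cor. 1.10 / Prop. 1.4; the witnesses are not models of any curve;
typed ≠ proved; nothing here bears on the disputed [IUTchIII] Cor. 3.12; no side taken.
-/

noncomputable section

open CategoryTheory Topology

namespace Literature.AnabelianGeometry.AbsoluteAnabelian

namespace AbsTopIII

namespace CurveModel

open FundamentalExtension

/-! ### Joint closures: the Prop. 1.4 named facts do not imply Thm. 1.9 (b) / Cor. 1.10 (ii)(c) over the interface -/

/-- **F-0346 is independent of F-0339 / F-0340 / F-0341 over the interface** (universe `0`): even the
JOINT closure "`∀ M, Prop_1_4_i M → Prop_1_4_i' M → Prop_1_4_ii M → Thm_1_9_b M`" is false.  At the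
two-point witness interface of `not_forall_thm_1_9_b` (`U ↦ Π_U = Ẑ × G_ℚ ↠ G_ℚ`, one rational cusp
with `D_z = Π_U`, `I_z = Δ_U = Ẑ × 1`; `Z ↦` the point extension; `res = pr₂`) all three Prop. 1.4
named facts HOLD: (i) `I_z ≅ Ẑ` (`isFreeProcyclic_zHatCompletion`); (i′) `Π_U ↠ Π_Z` is onto, the
identity on `G_ℚ`, with kernel `Δ_U = I_z` — closed and normal, so its own closed normal closure;
(ii) the cuspidal kernel is `Δ_U`, which is commutative (dense cyclic subgroup,
`mul_comm_of_dense_zpowers`), so `[N, Δ_U]⁻ = 1` and `1 → I_z → Δ^{c-cn} → Δ_Z → 1` is exact as typed —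
while `M_Z` is trivial.  Reading (R5, honest): over the axiom-free interface the content of
Thm. 1.9 (b) is carried by the Leray-differential fact `Prop_1_4_ii_transgression` (F-0338 — not
examined here; its target `H²(Δ_Z, Ẑ)` vanishes at this witness) and the model laws of
`CoherentKummerModel` (conditional discharge `CoherentKummerModel.thm_1_9_b`), not by Prop. 1.4
(i)/(i′)/(ii) as typed.
[cite: MochizukiAbsTopIII2015, Thm 1.9 (b) p.37] [cite: MochizukiAbsTopIII2015, Prop 1.4 (i) p.31] -/
theorem not_forall_thm_1_9_b_of_prop_1_4 :
    ¬ ∀ M : CurveModel.{0}, M.Prop_1_4_i → M.Prop_1_4_i' → M.Prop_1_4_ii →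
      Literature.AnabelianGeometry.AbsoluteAnabelian.AbsTopIII.CurveModel.Thm_1_9_b M := by
  intro h
  -- the two extensions over `G_ℚ` (as in `not_forall_thm_1_9_b`)
  let Γ : ProfiniteGrp.{0} := absoluteGaloisGrp ℚ
  let Z : ProfiniteGrp.{0} := ProfiniteGrp.ProfiniteCompletion.completion (GrpCat.of (Multiplicative ℤ))
  let EU : FundamentalExtension.{0} :=
    { arith := ProfiniteGrp.of (Z × Γ), gal := Γ, aug := ContinuousMonoidHom.snd Z Γ,
      aug_surjective := Prod.snd_surjective }
  let Ept : FundamentalExtension.{0} :=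
    { arith := Γ, gal := Γ, aug := ContinuousMonoidHom.id _, aug_surjective := Function.surjective_id }
  have hEpt : Ept.geom = ⊥ := (MonoidHom.ker_eq_bot_iff _).mpr Function.injective_id
  have hmem : ∀ z : Z, ((z, 1) : Z × Γ) ∈ EU.geom := fun z => EU.mem_geom.2 rfl
  have eZ : (Z : Type) ≃ₜ* EU.geom :=
    { toFun := fun z => ⟨(z, 1), hmem z⟩
      invFun := fun g => g.1.1
      left_inv := fun _ => rfl
      right_inv := fun g => Subtype.ext (Prod.ext rfl (EU.mem_geom.1 g.2).symm)
      map_mul' := fun z z' => Subtype.ext (Prod.ext rfl (mul_one _).symm)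
      continuous_toFun := (continuous_id.prodMk continuous_const).subtype_mk hmem
      continuous_invFun := continuous_fst.comp continuous_subtype_val }
  have hfree : IsFreeProcyclic EU.geom := isFreeProcyclic_zHatCompletion.of_continuousMulEquiv eZ
  -- `Δ_U ≅ Ẑ` is commutative, hence `[Δ_U, Δ_U] = 1`
  have hcomm : ⁅EU.geom, EU.geom⁆ = ⊥ := by
    obtain ⟨γ, hγ⟩ := hfree.exists_dense_zpowers
    rw [Subgroup.commutator_eq_bot_iff_le_centralizer]
    intro x hx
    rw [Subgroup.mem_centralizer_iff]
    intro y hy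
    exact congrArg Subtype.val (mul_comm_of_dense_zpowers hγ ⟨y, hy⟩ ⟨x, hx⟩)
  have hbotU : (⊥ : Subgroup EU.arith).topologicalClosure = ⊥ :=
    le_bot_iff.1 (Subgroup.topologicalClosure_minimal _ le_rfl (by
      rw [Subgroup.coe_bot]
      exact isClosed_singleton))
  let CU : EU.CuspidalData :=
    { Cusp := PUnit
      Dcusp := fun _ => ⊤
      Icusp := fun _ => EU.geom
      Icusp_eq := fun _ => (top_inf_eq EU.geom).symm
      isClosed_Dcusp := fun _ => by
        rw [Subgroup.coe_top]
        exact isClosed_univ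
      eq_of_conj := fun x y _ _ => Subsingleton.elim x y }
  let Cpt : Ept.CuspidalData :=
    { Cusp := PEmpty
      Dcusp := fun c => c.elim
      Icusp := fun c => c.elim
      Icusp_eq := fun c => c.elim
      isClosed_Dcusp := fun c => c.elim
      eq_of_conj := fun c => c.elim }
  let r : EU ⟶ Ept := ⟨ContinuousMonoidHom.snd Z Γ, ContinuousMonoidHom.id _, fun _ => rfl⟩
  -- the kernel of `pr₂ : Π_U ↠ Π_Z` IS `Δ_U` (definitionally), a closed normal subgroup
  have hker : r.arith.toMonoidHom.ker = EU.geom := rfl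
  haveI : EU.geom.Normal := EU.normal_geom
  have hclU : (Subgroup.normalClosure (EU.geom : Set EU.arith)).topologicalClosure = EU.geom := by
    rw [Subgroup.normalClosure_eq_self]
    exact le_antisymm (Subgroup.topologicalClosure_minimal _ le_rfl EU.isClosed_geom)
      (Subgroup.le_topologicalClosure _)
  let ext : ULift.{1, 0} Bool → FundamentalExtension.{0} := fun b => cond b.down EU Ept
  let M : CurveModel.{0} :=
    { Curve := ULift.{1, 0} Bool
      base := fun _ => ℚ
      ext := ext
      galIso := fun b => Bool.rec (motive := fun c => ((cond c EU Ept).gal ≅ absoluteGaloisGrp ℚ))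
        (Iso.refl _) (Iso.refl _) b.down
      cusps := fun b => Bool.rec (motive := fun c => (cond c EU Ept).CuspidalData) Cpt CU b.down
      IsProper := fun _ => True
      IsScheme := fun _ => True
      genus := fun _ => 2
      FunctionField := fun _ => ℚ
      Point := fun _ => PEmpty
      decomp := fun _ x => x.elim
      IsNFCurve := fun _ => False
      IsNFPoint := fun _ x => x.elim
      IsNFRational := fun _ _ => False
      IsNFConstant := fun _ _ => False
      NFFunctionField := fun _ => ℚ
      IsStrictlyBelyiType := fun _ => False
      IsCofiniteOpen := fun U U' => U.down = true ∧ U'.down = false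
      res := fun {U U'} hUU' => match U, U', hUU' with
        | ⟨true⟩, ⟨false⟩, _ => r
        | ⟨true⟩, ⟨true⟩, hUU' => Bool.noConfusion hUU'.2
        | ⟨false⟩, _, hUU' => Bool.noConfusion hUU'.1 }
  -- Prop. 1.4 (i): every cuspidal inertia group is free procyclic
  have h14i : M.Prop_1_4_i := by
    rintro ⟨_ | _⟩ -
    · exact fun c => c.elim
    · exact fun _ => hfree
  -- Prop. 1.4 (i'): `Π_U ↠ Π_Z` onto, identity on `G`, kernel the closed normal closure of `I_z`
  have h14 : M.Prop_1_4_i' := by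
    rintro ⟨_ | _⟩ ⟨_ | _⟩ hUU' - -
    · exact Bool.noConfusion hUU'.1
    · exact Bool.noConfusion hUU'.1
    · refine ⟨Prod.snd_surjective, Function.bijective_id, Set.univ, ?_⟩
      change r.arith.toMonoidHom.ker =
        (Subgroup.normalClosure (⋃ c ∈ (Set.univ : Set PUnit), (EU.geom : Set EU.arith))).topologicalClosure
      rw [hker, Set.biUnion_univ, Set.iUnion_const, hclU]
    · exact Bool.noConfusion hUU'.2
  -- Prop. 1.4 (ii): `1 → I_z → Δ^{c-cn} → Δ_Z → 1` (cuspidal kernel `Δ_U`, `[Δ_U, Δ_U]⁻ = 1`)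
  have h142 : M.Prop_1_4_ii := by
    rintro ⟨_ | _⟩ ⟨_ | _⟩ hUU' - - - x - -
    · exact Bool.noConfusion hUU'.1
    · exact Bool.noConfusion hUU'.1
    · have hN : cuspidalKernel r = EU.geom := by
        change r.arith.toMonoidHom.ker ⊓ EU.geom = EU.geom
        rw [hker, inf_idem]
      have hC : cuspidallyCentralModulus r = ⊥ := by
        change (⁅cuspidalKernel r, EU.geom⁆).topologicalClosure = ⊥
        rw [hN, hcomm, hbotU]
      change IsCuspidallyCentralExtension r EU.geom
      exact ⟨by rw [hC, inf_bot_eq], by rw [hC, sup_bot_eq, hN]⟩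
    · exact Bool.noConfusion hUU'.2
  have hrat : ∀ c : (M.cusps (ULift.up true)).Cusp, (M.cusps (ULift.up true)).IsRational c :=
    fun _ g _ => ⟨((1 : Z), g), Subgroup.mem_top _, rfl⟩
  obtain ⟨φ, -⟩ := h M h14i h14 h142 (ULift.up true) (ULift.up false) ⟨rfl, rfl⟩ trivial trivial
    trivial le_rfl hrat PUnit.unit hfree
  haveI : Subsingleton (CyclotomeMod (M.ext (ULift.up false)) ZHatCoeff.{0}) :=
    CyclotomeMod.subsingleton_of_geom_eq_bot Ept _ hEpt
  haveI : Subsingleton EU.geom := φ.injective.subsingleton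
  exact not_isFreeProcyclic_of_subsingleton hfree

/-- **F-0348 is independent of the whole Prop. 1.4 package AND of Thm. 1.9 (b) over the interface**
(universe `0`): the joint closure "`∀ M, Prop_1_4_i M → Prop_1_4_i' M → Prop_1_4_ii M →
Prop_1_4_ii_transgression M → Thm_1_9_b M → Cor_1_10_ii_c M`" is false.  At the one-point witness
interface of `not_forall_cor_1_10_ii_c` (the point extension `Π_X = G_{ℚ_2}`, NO cusps, `res = 𝟙`)
every cusp-indexed fact — (i), (ii), the transgression fact, Thm. 1.9 (b) — holds VACUOUSLY, and (i′)
holds genuinely (`𝟙` is onto, bijective on `G`, with kernel `1` = the closed normal closure of the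
empty family of inertia groups), while `M_X` is trivial and `μ_Ẑ(G_{ℚ_2})` is not.  Reading (R5,
honest): the cyclotomic synchronization `μ_Ẑ(G_k) ⥲ μ_Ẑ(Π_X)` is content of its own (for a proper
hyperbolic curve it rests on `H²(Δ_X, Ẑ) ≅ Ẑ` for the surface group `Δ_X` and the degree map), not a
consequence of the §1 facts typed so far; consumable only at a named model.
[cite: MochizukiAbsTopIII2015, Cor 1.10 (ii) p.42] [cite: MochizukiAbsTopIII2015, Prop 1.4 (i) p.31] -/
theorem not_forall_cor_1_10_ii_c_of_prop_1_4 :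
    ¬ ∀ M : CurveModel.{0}, M.Prop_1_4_i → M.Prop_1_4_i' → M.Prop_1_4_ii →
      M.Prop_1_4_ii_transgression → M.Thm_1_9_b →
      Literature.AnabelianGeometry.AbsoluteAnabelian.AbsTopIII.CurveModel.Cor_1_10_ii_c M := by
  intro h
  haveI : Fact (Nat.Prime 2) := ⟨Nat.prime_two⟩
  have hk : IsMLF ℚ_[2] := by
    refine ⟨⟨2, inferInstance, RingHom.id _, ?_⟩⟩
    letI : Algebra ℚ_[2] ℚ_[2] := (RingHom.id ℚ_[2]).toAlgebra
    exact Module.Finite.of_surjective (Algebra.linearMap ℚ_[2] ℚ_[2]) fun y => ⟨y, rfl⟩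
  let Ept : FundamentalExtension.{0} :=
    { arith := absoluteGaloisGrp ℚ_[2], gal := absoluteGaloisGrp ℚ_[2], aug := ContinuousMonoidHom.id _,
      aug_surjective := Function.surjective_id }
  have hEpt : Ept.geom = ⊥ := (MonoidHom.ker_eq_bot_iff _).mpr Function.injective_id
  have hbot : (⊥ : Subgroup Ept.arith).topologicalClosure = ⊥ :=
    le_bot_iff.1 (Subgroup.topologicalClosure_minimal _ le_rfl (by
      rw [Subgroup.coe_bot]
      exact isClosed_singleton))
  let Cpt : Ept.CuspidalData :=
    { Cusp := PEmpty
      Dcusp := fun c => c.elim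
      Icusp := fun c => c.elim
      Icusp_eq := fun c => c.elim
      isClosed_Dcusp := fun c => c.elim
      eq_of_conj := fun c => c.elim }
  let M : CurveModel.{0} :=
    { Curve := PUnit
      base := fun _ => ℚ_[2]
      ext := fun _ => Ept
      galIso := fun _ => Iso.refl _
      cusps := fun _ => Cpt
      IsProper := fun _ => True
      IsScheme := fun _ => True
      genus := fun _ => 2
      FunctionField := fun _ => ℚ_[2]
      Point := fun _ => PEmpty
      decomp := fun _ x => x.elim
      IsNFCurve := fun _ => False
      IsNFPoint := fun _ x => x.elim
      IsNFRational := fun _ _ => False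
      IsNFConstant := fun _ _ => False
      NFFunctionField := fun _ => ℚ_[2]
      IsStrictlyBelyiType := fun _ => False
      IsCofiniteOpen := fun _ _ => True
      res := fun _ => 𝟙 _ }
  -- the cusp-indexed facts hold vacuously; (i') genuinely
  have h14i : M.Prop_1_4_i := fun _ _ c => c.elim
  have h14 : M.Prop_1_4_i' := by
    intro U U' hUU' _ _
    refine ⟨Function.surjective_id, Function.bijective_id, ∅, ?_⟩
    change (ContinuousMonoidHom.id _).toMonoidHom.ker =
      (Subgroup.normalClosure (⋃ c ∈ (∅ : Set PEmpty), ((Cpt.Icusp c : Subgroup Ept.arith) : Set Ept.arith))).topologicalClosure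
    rw [Set.biUnion_empty, Subgroup.normalClosure_eq_bot_iff.2 (Set.empty_subset _), hbot]
    exact hEpt
  have h142 : M.Prop_1_4_ii := fun _ _ _ _ _ _ x => x.elim
  have hT : M.Prop_1_4_ii_transgression := fun _ _ _ x => x.elim
  have h19 : M.Thm_1_9_b := fun _ _ _ _ _ _ _ _ z => z.elim
  obtain ⟨φ, -⟩ := h M h14i h14 h142 hT h19 PUnit.unit PUnit.unit trivial trivial trivial trivial
    le_rfl hk
  haveI : Subsingleton (CyclotomeMod (M.ext PUnit.unit) ZHatCoeff.{0}) :=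
    CyclotomeMod.subsingleton_of_geom_eq_bot Ept _ hEpt
  have hμ : Subsingleton (muZhat (Field.absoluteGaloisGroup ℚ_[2])) := φ.injective.subsingleton
  obtain ⟨e, -⟩ := exists_muZhat_mulEquiv_cyclotome_units_of_isMLF ℚ_[2] hk
  haveI : CharZero (AlgebraicClosure ℚ_[2]) :=
    charZero_of_injective_algebraMap (algebraMap ℚ_[2] (AlgebraicClosure ℚ_[2])).injective
  obtain ⟨ξ, -, hξ, -⟩ :=
    EtaleTheta.cyclotome.exists_generator_mulEquiv_zHat_of_isSepClosed (AlgebraicClosure ℚ_[2])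
  have hξ1 : ξ ≠ 1 := fun h1 => by
    have h2 := hξ 2
    rw [h1] at h2
    exact h2.ne_one (by decide) rfl
  haveI : Subsingleton (EtaleTheta.cyclotome (AlgebraicClosure ℚ_[2])ˣ) := e.symm.injective.subsingleton
  exact hξ1 (Subsingleton.elim _ _)

end CurveModel

end AbsTopIII

end Literature.AnabelianGeometry.AbsoluteAnabelian

end
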